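import Summits.CriticalPhenomena.SAWScalingLimit.Theorems.HexConjecture.Negative.Reversal
import Literature.Probability.RandomPlanarGeometry.HexSAW
import Literature.Probability.RandomPlanarGeometry.PlanarDomains
import Literature.Probability.Percolation.LoopRotationInvarianceAssembly
import Literature.Probability.Percolation.CLE6Proofs
import HarnessLib

/-!
# `NoLateReturn` from its b-clause by exact lattice reversibility (+ the trivial regime `diam D̄ < ε`)

Glue for crux `Summit.CriticalPhenomena.SAWScalingLimit.Theses.SAWDevelopingMap.HexTight`
(stmt-CriticalPhenomena-5423, shared verbatim with `…Theses.SAWResidueField.HexTight`), line `reversible-driving`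
(skeleton `Cruxes/HexTight/Lines/reversible_driving.lean`), stub 4 `stub_noLateReturn` ("no late return to the marked
points" for the critical hexagonal SAW law `hexSAWLaw`).  The registered r3 statement has TWO clauses: (b) the SAW
polyline does not visit the closed `η`-neighbourhood of the target `b = D.pt 1` and AFTERWARDS a point at distance
`≥ ε` from `b`; (a) it does not visit a point at distance `≥ ε` from the source `a = D.pt 0` and AFTERWARDS the closed
`η`-neighbourhood of `a`.

**Main theorem (`noLateReturn_of_noLateExcursion`).** The two-clause statement follows from the b-clause ALONE
(quantified over all Dobrushin domains and hexagonal endpoint approximations): the a-clause for `(D; a_δ → b_δ)` is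
the b-clause for the reversed family `(D.swap; b_δ → a_δ)`.  Ingredients: the exact lattice reversibility
`hexSAWLaw Ω δ a b = (hexSAWLaw Ω δ b a).map sawReverse` and `isEmbEndpointApprox_swap` of
`Theorems/HexConjecture/Negative/Reversal.lean` (p74061), and the deterministic fact that reversing the vertex list
reverses the ORDER in which the polyline visits two sets (`exists_le_polyline_reverse_iff`: both polylines are
monotone traversals of one affine interpolation, `polyline_cons_apply` + `affineInterp_reverse`, and `dyadicTime`
is onto `[0, n]` by the intermediate value theorem) — an exact statement, no closedness of the sets needed.

**Trivial regime (`noLateReturn_of_diam_lt`).** If `ε` exceeds `diam (closure D)`, both events are empty for all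
small meshes (once `a_δ ≠ b_δ` the polyline lies in `closure D ∋ D.pt i`), so the conclusion holds with any `η`.
This is the only regime provable with present tools; the genuine estimate is research-open (worker report
`NoLateReturn-REPORT.md` of the line folder).

All statements are [folklore].
(buildfix 2026-08-20: comment-only re-land to re-enqueue the module build after its blocking imports were repaired; no declaration changed.)
-/

noncomputable section

open scoped ENNReal NNReal Topology unitInterval
open MeasureTheory Filter Topology Set Metric
open Literature Literature.Probability Literature.Probability.LatticeModels
  Literature.Probability.RandomPlanarGeometry Literature.Probability.RandomPlanarGeometry.SAW
open Summit.CriticalPhenomena.SAWScalingLimit.Cruxes.HexConjecture.Reversal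

namespace Summit.CriticalPhenomena.SAWScalingLimit.Theorems.HexTight.ReversibleDriving

namespace NoLateReturnReduction

/-! ## §1 Reversing a vertex list reverses the order of visits of its polyline -/

section Polyline

open Literature.Probability.Percolation

variable {E : Type*} [NormedAddCommGroup E] [NormedSpace ℝ E]

/-- `dyadicTime n` maps `[0, 1]` into `[0, n]`. [folklore] -/
theorem dyadicTime_mem_Icc (n : ℕ) (s : I) : dyadicTime n s ∈ Icc (0 : ℝ) n := by
  refine ⟨dyadicTime_nonneg n s.2.1, ?_⟩
  have h := monotone_dyadicTime n s.2.2
  rwa [dyadicTime_apply_one] at h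

/-- `dyadicTime n` maps `[0, 1]` ONTO `[0, n]` (intermediate value theorem). [folklore] -/
theorem exists_dyadicTime_eq (n : ℕ) {u : ℝ} (hu : u ∈ Icc (0 : ℝ) n) :
    ∃ s : I, dyadicTime n s = u := by
  have h := intermediate_value_Icc (zero_le_one (α := ℝ)) (continuous_dyadicTime n).continuousOn
  rw [dyadicTime_apply_zero, dyadicTime_apply_one] at h
  obtain ⟨s, hs, hsu⟩ := h hu
  exact ⟨⟨s, hs⟩, hsu⟩

/-- The polyline through the reversed list, evaluated at time `s`, is the affine interpolation of the
original list at parameter `n - dyadicTime n s`. [folklore] -/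
theorem polyline_reverse_apply (a : E) (l : List E) (s : I) :
    LatticeModels.polyline (a :: l).reverse s =
      affineInterp (a :: l) ((l.length : ℝ) - dyadicTime l.length s) := by
  obtain ⟨a', l', h'⟩ := List.exists_cons_of_ne_nil (List.reverse_ne_nil_iff.2 (List.cons_ne_nil a l))
  have hlen : l'.length = l.length := by
    have := congrArg List.length h'
    simp only [List.length_reverse, List.length_cons] at this
    omega
  rw [h', polyline_cons_apply, hlen, ← h', affineInterp_reverse a l (dyadicTime_mem_Icc _ _)]

/-- One direction of `exists_le_polyline_reverse_iff`: if the polyline through `l.reverse` visits `A` and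
later `B`, then the polyline through `l` visits `B` and later `A`. [folklore] -/
theorem exists_le_polyline_of_reverse (l : List E) {A B : Set E}
    (h : ∃ s t : I, s ≤ t ∧ LatticeModels.polyline l.reverse s ∈ A ∧
      LatticeModels.polyline l.reverse t ∈ B) :
    ∃ s t : I, s ≤ t ∧ LatticeModels.polyline l s ∈ B ∧ LatticeModels.polyline l t ∈ A := by
  obtain ⟨s, t, hst, hA, hB⟩ := h
  rcases eq_or_ne l [] with rfl | hl
  · simp only [List.reverse_nil, LatticeModels.polyline_nil, ContinuousMap.const_apply] at hA hB
    exact ⟨0, 0, le_rfl, by simpa using hB, by simpa using hA⟩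
  obtain ⟨a, l, rfl⟩ := List.exists_cons_of_ne_nil hl
  set n : ℕ := l.length with hn
  rw [polyline_reverse_apply] at hA hB
  -- parameters of the two visits along the ORIGINAL interpolation, in the right order
  set u : ℝ := (n : ℝ) - dyadicTime n s with hu
  set v : ℝ := (n : ℝ) - dyadicTime n t with hv
  have hsI := dyadicTime_mem_Icc n s
  have htI := dyadicTime_mem_Icc n t
  have hvu : v ≤ u := by
    have := monotone_dyadicTime n (show (s : ℝ) ≤ t from hst)
    simp only [hu, hv]; linarith
  have huI : u ∈ Icc (0 : ℝ) n := ⟨by simp only [hu]; linarith [hsI.2], by simp only [hu]; linarith [hsI.1]⟩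
  have hvI : v ∈ Icc (0 : ℝ) n := ⟨by simp only [hv]; linarith [htI.2], by simp only [hv]; linarith [htI.1]⟩
  obtain ⟨s', hs'⟩ := exists_dyadicTime_eq n hvI
  obtain ⟨t', ht'⟩ := exists_dyadicTime_eq n huI
  rcases le_or_gt s' t' with hle | hlt
  · refine ⟨s', t', hle, ?_, ?_⟩
    · rw [polyline_cons_apply, hs']; exact hB
    · rw [polyline_cons_apply, ht']; exact hA
  · -- `t' < s'` forces `u = v`: both visits happen at the same parameter
    have huv : u = v := by
      have := monotone_dyadicTime n (show (t' : ℝ) ≤ s' from hlt.le)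
      rw [hs', ht'] at this
      exact le_antisymm this hvu
    refine ⟨s', s', le_rfl, ?_, ?_⟩
    · rw [polyline_cons_apply, hs']; exact hB
    · rw [polyline_cons_apply, hs', ← huv]; exact hA

/-- **Reversing the vertex list reverses the order of visits**: the polyline through `l.reverse` visits
`A` and later `B` iff the polyline through `l` visits `B` and later `A`. [folklore] -/
theorem exists_le_polyline_reverse_iff (l : List E) {A B : Set E} :
    (∃ s t : I, s ≤ t ∧ LatticeModels.polyline l.reverse s ∈ A ∧
        LatticeModels.polyline l.reverse t ∈ B) ↔
      ∃ s t : I, s ≤ t ∧ LatticeModels.polyline l s ∈ B ∧ LatticeModels.polyline l t ∈ A :=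
  ⟨exists_le_polyline_of_reverse l, fun h =>
    exists_le_polyline_of_reverse l.reverse (by rwa [List.reverse_reverse])⟩

end Polyline

/-! ## §2 Walk level and law level (time reversal `sawReverse` of `Theorems/HexConjecture/Negative/Reversal.lean`) -/

section Walk

variable {V : Type*} {G : SimpleGraph V} {emb : V → ℂ} {Ω : Set ℂ} {δ : ℝ} {a b : V}

/-- **Reversing the walk reverses the order in which its polyline visits two sets.** [folklore] -/
theorem exists_le_toCurve_sawReverse_iff (f : V → ℂ) (γ : EmbDomainSAW G emb Ω δ a b) {A B : Set ℂ} :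
    (∃ s t : I, s ≤ t ∧ (sawReverse γ).walk.toCurve f s ∈ A ∧ (sawReverse γ).walk.toCurve f t ∈ B) ↔
      ∃ s t : I, s ≤ t ∧ γ.walk.toCurve f s ∈ B ∧ γ.walk.toCurve f t ∈ A := by
  simp only [SimpleGraph.Walk.toCurve, walk_sawReverse, SimpleGraph.Walk.support_reverse, List.map_reverse]
  exact exists_le_polyline_reverse_iff _

end Walk

/-- **"`ε`-far from `c`, then `η`-close to `c`" under `P^{(u,v)}_δ` has the same mass as "`η`-close to `c`, then
`ε`-far from `c`" under `P^{(v,u)}_δ`** — every mesh, every pair of endpoints, junk cases included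
(`hexSAWLaw Ω δ u v = (hexSAWLaw Ω δ v u).map sawReverse`). [folklore] -/
theorem hexSAWLaw_farThenNear_eq_nearThenFar (Ω : Set ℂ) (δ : ℝ) (u v : HexVertex) (c : ℂ) (ε η : ℝ) :
    hexSAWLaw Ω δ u v
        {γ | ∃ s t : unitInterval, s ≤ t ∧
          ε ≤ dist ((γ.walk.toCurve fun w => (δ : ℂ) * hexCenter w) s) c ∧
          dist ((γ.walk.toCurve fun w => (δ : ℂ) * hexCenter w) t) c ≤ η} =
      hexSAWLaw Ω δ v u
        {γ | ∃ s t : unitInterval, s ≤ t ∧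
          dist ((γ.walk.toCurve fun w => (δ : ℂ) * hexCenter w) s) c ≤ η ∧
          ε ≤ dist ((γ.walk.toCurve fun w => (δ : ℂ) * hexCenter w) t) c} := by
  rw [hexSAWLaw_swap Ω δ v u,
    Measure.map_apply (EmbDomainSAW.measurable_of_top _) MeasurableSpace.measurableSet_top]
  congr 1
  ext γ
  simp only [Set.mem_preimage, Set.mem_setOf_eq]
  exact exists_le_toCurve_sawReverse_iff (A := {z | ε ≤ dist z c}) (B := {z | dist z c ≤ η}) _ γ

/-! ## §3 The trivial regime: `ε` beyond the diameter of `D̄` (both events empty) -/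

section TrivialRegime

variable {Ω : Set ℂ} {δ : ℝ} {u v : HexVertex}

/-- For distinct endpoints, the SAW polyline stays in `closure Ω` (every dart is an edge of `Ω_δ`, whose
rescaled segment lies in `Ω̄`). [folklore] -/
theorem range_toCurve_subset_closure (huv : u ≠ v) (γ : HexDomainSAW Ω δ u v) :
    Set.range (γ.walk.toCurve fun w => (δ : ℂ) * hexCenter w) ⊆ closure Ω := by
  refine SimpleGraph.Walk.range_toCurve_subset_of_not_nil ?_ fun d hd => ?_
  · exact fun hnil => huv hnil.eq
  · exact ((embMeshGraph_adj_iff hexGraph hexCenter).1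
      ((embDomainGraph_adj_iff hexGraph hexCenter).1 d.adj).1).2

/-- Two mesh-point families converging to the two DISTINCT marked points are eventually distinct vertices.
[folklore] -/
theorem eventually_ne_of_isEmbEndpointApprox {D : DobrushinDomain} {a b : ℝ → HexVertex}
    (hab : IsEmbEndpointApprox hexGraph hexCenter D a b) : ∀ᶠ δ : ℝ in 𝓝[>] (0 : ℝ), a δ ≠ b δ := by
  obtain ⟨U, V, hU, hV, haU, hbV, hUV⟩ :=
    t2_separation (D.pt_injective.ne (show (0 : Fin 2) ≠ 1 by decide))
  filter_upwards [hab.tendsto_fst (hU.mem_nhds haU), hab.tendsto_snd (hV.mem_nhds hbV)] with δ hδa hδb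
  intro h
  simp only [Set.mem_preimage] at hδa hδb
  rw [h] at hδa
  exact Set.disjoint_left.1 hUV hδa hδb

end TrivialRegime

end NoLateReturnReduction

open NoLateReturnReduction

/-- **Trivial regime of `stub_noLateReturn`.** If `ε` exceeds the diameter of `closure D`, both events of the
stub are EMPTY for all small meshes (the polyline lies in `D̄ ∋ a, b`), so its conclusion holds with any `η`.
[folklore] -/
theorem noLateReturn_of_diam_lt {D : DobrushinDomain} {a b : ℝ → HexVertex}
    (hab : IsEmbEndpointApprox hexGraph hexCenter D a b) {ε : ℝ} (hε : Metric.diam (closure D.carrier) < ε)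
    (p η : ℝ) : ∀ᶠ δ : ℝ in 𝓝[>] (0 : ℝ),
      hexSAWLaw D.carrier δ (a δ) (b δ)
          {γ | ∃ s t : unitInterval, s ≤ t ∧
            dist ((γ.walk.toCurve fun v => (δ : ℂ) * hexCenter v) s) (D.pt 1) ≤ η ∧
            ε ≤ dist ((γ.walk.toCurve fun v => (δ : ℂ) * hexCenter v) t) (D.pt 1)}
        ≤ ENNReal.ofReal p ∧
      hexSAWLaw D.carrier δ (a δ) (b δ)
          {γ | ∃ s t : unitInterval, s ≤ t ∧
            ε ≤ dist ((γ.walk.toCurve fun v => (δ : ℂ) * hexCenter v) s) (D.pt 0) ∧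
            dist ((γ.walk.toCurve fun v => (δ : ℂ) * hexCenter v) t) (D.pt 0) ≤ η}
        ≤ ENNReal.ofReal p := by
  have hbdd : Bornology.IsBounded (closure D.carrier) := D.isBounded.closure
  have hfar : ∀ {δ : ℝ}, a δ ≠ b δ → ∀ (γ : HexDomainSAW D.carrier δ (a δ) (b δ)) (t : unitInterval)
      (i : Fin 2), dist ((γ.walk.toCurve fun v => (δ : ℂ) * hexCenter v) t) (D.pt i) < ε := by
    intro δ hne γ t i
    refine lt_of_le_of_lt (Metric.dist_le_diam_of_mem hbdd ?_ ?_) hε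
    · exact range_toCurve_subset_closure hne γ ⟨t, rfl⟩
    · exact frontier_subset_closure (D.pt_mem_frontier i)
  filter_upwards [eventually_ne_of_isEmbEndpointApprox hab] with δ hne
  have h1 : {γ : HexDomainSAW D.carrier δ (a δ) (b δ) | ∃ s t : unitInterval, s ≤ t ∧
      dist ((γ.walk.toCurve fun v => (δ : ℂ) * hexCenter v) s) (D.pt 1) ≤ η ∧
      ε ≤ dist ((γ.walk.toCurve fun v => (δ : ℂ) * hexCenter v) t) (D.pt 1)} = ∅ := by
    ext γ
    simp only [Set.mem_setOf_eq, Set.mem_empty_iff_false, iff_false, not_exists, not_and, not_le]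
    exact fun s t _ _ => hfar hne γ t 1
  have h0 : {γ : HexDomainSAW D.carrier δ (a δ) (b δ) | ∃ s t : unitInterval, s ≤ t ∧
      ε ≤ dist ((γ.walk.toCurve fun v => (δ : ℂ) * hexCenter v) s) (D.pt 0) ∧
      dist ((γ.walk.toCurve fun v => (δ : ℂ) * hexCenter v) t) (D.pt 0) ≤ η} = ∅ := by
    ext γ
    simp only [Set.mem_setOf_eq, Set.mem_empty_iff_false, iff_false, not_exists, not_and]
    exact fun s _ _ hs => absurd hs (not_le.2 (hfar hne γ s 0))
  rw [h1, h0, measure_empty]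
  exact ⟨bot_le, bot_le⟩

/-- **`NoLateReturn` (two clauses, = the r3 `stub_noLateReturn` VERBATIM) follows from the NO-LATE-EXCURSION clause
alone** (the b-clause, for every Dobrushin domain and every hexagonal endpoint approximation): apply it to
`(D; a, b)` for the b-clause and to the reversed family on `D.swap` (`isEmbEndpointApprox_swap`,
`hexSAWLaw_farThenNear_eq_nearThenFar`, `pt_swap_one`) for the a-clause; `η := min η₁ η₂`. [folklore] -/
theorem noLateReturn_of_noLateExcursion :
    (∀ (D : DobrushinDomain) (a b : ℝ → HexVertex), IsEmbEndpointApprox hexGraph hexCenter D a b →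
      ∀ ε : ℝ, 0 < ε → ∀ p : ℝ, 0 < p → ∃ η : ℝ, 0 < η ∧ ∀ᶠ δ : ℝ in 𝓝[>] (0 : ℝ),
        hexSAWLaw D.carrier δ (a δ) (b δ)
            {γ | ∃ s t : unitInterval, s ≤ t ∧
              dist ((γ.walk.toCurve fun v => (δ : ℂ) * hexCenter v) s) (D.pt 1) ≤ η ∧
              ε ≤ dist ((γ.walk.toCurve fun v => (δ : ℂ) * hexCenter v) t) (D.pt 1)}
          ≤ ENNReal.ofReal p) →
    ∀ (D : DobrushinDomain) (a b : ℝ → HexVertex), IsEmbEndpointApprox hexGraph hexCenter D a b →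
    ∀ ε : ℝ, 0 < ε → ∀ p : ℝ, 0 < p → ∃ η : ℝ, 0 < η ∧ ∀ᶠ δ : ℝ in 𝓝[>] (0 : ℝ),
      hexSAWLaw D.carrier δ (a δ) (b δ)
          {γ | ∃ s t : unitInterval, s ≤ t ∧
            dist ((γ.walk.toCurve fun v => (δ : ℂ) * hexCenter v) s) (D.pt 1) ≤ η ∧
            ε ≤ dist ((γ.walk.toCurve fun v => (δ : ℂ) * hexCenter v) t) (D.pt 1)}
        ≤ ENNReal.ofReal p ∧
      hexSAWLaw D.carrier δ (a δ) (b δ)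
          {γ | ∃ s t : unitInterval, s ≤ t ∧
            ε ≤ dist ((γ.walk.toCurve fun v => (δ : ℂ) * hexCenter v) s) (D.pt 0) ∧
            dist ((γ.walk.toCurve fun v => (δ : ℂ) * hexCenter v) t) (D.pt 0) ≤ η}
        ≤ ENNReal.ofReal p := by
  intro h D a b hab ε hε p hp
  obtain ⟨η₁, hη₁, h₁⟩ := h D a b hab ε hε p hp
  obtain ⟨η₂, hη₂, h₂⟩ := h D.swap b a (isEmbEndpointApprox_swap hab) ε hε p hp
  refine ⟨min η₁ η₂, lt_min hη₁ hη₂, ?_⟩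
  filter_upwards [h₁, h₂] with δ hδ₁ hδ₂
  constructor
  · refine le_trans (measure_mono ?_) hδ₁
    rintro γ ⟨s, t, hst, hs, ht⟩
    exact ⟨s, t, hst, hs.trans (min_le_left _ _), ht⟩
  · rw [hexSAWLaw_farThenNear_eq_nearThenFar]
    rw [MarkedDomain.pt_swap_one] at hδ₂
    refine le_trans (measure_mono ?_) hδ₂
    rintro γ ⟨s, t, hst, hs, ht⟩
    exact ⟨s, t, hst, hs.trans (min_le_right _ _), ht⟩

end Summit.CriticalPhenomena.SAWScalingLimit.Theorems.HexTight.ReversibleDriving
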